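/-
Copyright (c) 2026. Released under the Apache 2.0 license.
-/
import Mathlib.GroupTheory.Perm.Cycle.Type
import Literature.NumberTheory.EllipticCurves.ManinConstantQuadraticTwistAtTwoProofs
import HarnessLib

/-!
# The twist road at `2`, ordinary case: ALL the cases `η = 1` of Stevens 1989 Lemma (5.2)

Topic `Literature/NumberTheory/EllipticCurves`; namespaces `Literature.NumberTheory.EllipticCurves`
and `Literature.NumberTheory.EllipticCurves.ModularForms`. Theorems only; NO named fact.

Stevens (*Invent. Math.* 98 (1989)), Lemma (5.2) p. 96: for `A/ℚ` with Néron lattice `ℒ(A)` and a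
primitive quadratic character `ψ` whose conductor is prime to that of `A` except possibly at `2`
(where `A` is then semistable), `ℒ(A^ψ) = (η/τ(ψ)) ℒ(A)` with "`η = 2` if the conductor of `ψ` is
divisible by `8`, and `A` has good supersingular reduction at `2`; `1` otherwise". The companion
files `QuadraticTwistAtTwoMinimalModelProofs` / `ManinConstantQuadraticTwistAtTwoProofs` prove this
at conductor `4` and `8` (`d ∈ {−1, 2, −2}`) in the cases `η = 1` decided by the conductor of `A`:
`ψ = χ₋₄`, or `A` multiplicative at `2`; and the minimal-model statement also when `a₁` of the
minimal equation of `A` is odd (`isGloballyMinimal_quadraticTwist_four_mul_of_odd_a₁`). This file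
adds the remaining case `η = 1`: `ψ = χ_{±8}` and `A` good ORDINARY at `2`, read off the
isogeny-invariant datum `a₂(A) = (L(A, s))₂` odd:

* `odd_natCard_point_of_a₁_eq_zero_of_a₃_eq_one` — over `𝔽₂`, a Weierstrass curve with `a₁ = 0`,
  `a₃ = 1` has an ODD number of (nonsingular affine + `O`) points: `−(x, y) = (x, y + 1) ≠ (x, y)`
  (Silverman III.2.3), so no point has order `2` (Cauchy). This is the elementary half of
  "in characteristic `2`, supersingular `⟺ j = 0 ⟺ a₁ = 0`" (Silverman V.4, first paragraph;
  Exercises 5.7 and 5.10(a)).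
* `odd_a₁_of_hasGoodReductionAtPrime_two_of_odd_LFunction_two` — for `W/ℚ` globally minimal with
  good reduction at `2`: `a₂(W)` odd `⟹ a₁` odd (`a₂ = 3 − #Ẽ(𝔽₂)`,
  `LFunction_apply_prime_eq_frobeniusTrace`; semistable at `2 ⟹ a₁` or `a₃` odd).
* `isGloballyMinimal_quadraticTwist_four_mul_of_etaOne` — `W^{(4d)}`, `d ∈ {−1, 2, −2}`, is
  globally minimal for `W` semistable at `2` with `d = −1 ∨ W` multiplicative at `2 ∨ a₂(W)` odd
  (every case `η = 1`).
* `neronLattice_quadraticTwist_two_of_isGloballyMinimal` (the lattice statement from the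
  minimality of `W^{(4d)}` alone) and `neronLattice_quadraticTwist_two_of_etaOne`
  (`Λ(W ⊗ χ) = g(χ)⁻¹ Λ(W)` in every case `η = 1`).
* `not_dvd_maninConstant_of_isTwistOfSemistableAtTwo_etaOne_gamma0` — the per-pair certificate
  `2 ∤ c₀(𝒜)` of `ManinConstantQuadraticTwistAtTwoProofs` with the clause `d = −1 ∨ 2 ∣ N(W')`
  widened to `d = −1 ∨ 2 ∣ N(W') ∨ a₂(W')` odd; binders `hM hAU hC2 hnf` only.
* `classAbsManinConstantEqOne_of_forall_sq_prime_edixhoven_or_twist_or_twistAtTwo_gamma0` — the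
  class certificate (`Γ₀` road, binders `hM hAU hC hEA hEB hnf`) with the widened disjunct at `2`
  spelled out.

## What is printed and what is proved

Stevens states Lemma (5.2) with a one-line proof ("application of Tate's algorithm"). The
ordinary/supersingular distinction enters only at `2` for `ψ = χ_{±8}`: on the minimal equation of
`A` (good at `2`), `A mod 2` is ordinary iff `ā₁ ≠ 0` (Silverman V.4: the only supersingular
`j`-invariant in characteristic `2` is `j = 0 = ā₁¹²/Δ̄`), iff `#Ã(𝔽₂)` is even, iff `a₂(A)` is odd
(Exercise 5.10(a): supersingular iff `tr φ ≡ 0 (mod p)`). Only the implication used is proved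
here (`a₂` odd `⟹ a₁` odd), by the parity count above; the rest is the tree's.

## References
* [Stevens1989] G. Stevens, *Stickelberger elements and modular parametrizations of elliptic
  curves*, Invent. Math. 98 (1989) 75–106: Lemma (5.2) p. 96 (definition of `η`), (5.4) p. 97.
* [SilvermanAEC2009] J. H. Silverman, *The Arithmetic of Elliptic Curves*, 2nd ed. (2009):
  III.2.3 (group law, `−(x, y) = (x, −y − a₁x − a₃)`); V.4 first paragraph (PDF p. 135: "for
  `p = 2` … the only supersingular curve over `𝔽̄₂` is `y² + y = x³`"); Exercises 5.7, 5.10(a)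
  (PDF p. 139); VII.5 Prop. 5.1; Exercise 8.19(a).
* [Pal2012] V. Pal, Proc. AMS 140 (2012), Prop. 2.4 (Connell), case `p = 2`, `d ≡ 2 (mod 4)`.
* [Cesnavicius2018] K. Česnavičius, Compositio Math. 154 (2018), Thm. 1.2. [Mazur1978] Cor. 4.1.
  [AbbesUllmo1996] Thm. A. [EdixhovenManin1991] §1 and Thm. 3.
-/

noncomputable section

open scoped MatrixGroups ModularForm Classical

open CongruenceSubgroup WeierstrassCurve IsDedekindDomain IsDedekindDomain.HeightOneSpectrum
  NumberField Rat.HeightOneSpectrum Literature.NumberTheory.Automorphic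

namespace Literature.NumberTheory.EllipticCurves

/-! ### 1. Characteristic `2`: `a₁ = 0`, `a₃ = 1` ⟹ `#E(𝔽₂)` odd ⟹ `a₂` even -/

section CharTwo

/-- No `y ∈ 𝔽₂` satisfies `y = −y − 0·x − 1`. [folklore] -/
private theorem ne_negY_aux : ∀ x y : ZMod 2, y ≠ -y - 0 * x - 1 := by decide

/-- **Over `𝔽₂`, a Weierstrass curve with `a₁ = 0`, `a₃ = 1` has an odd number of points**
(nonsingular affine points plus `O`, Mathlib's `Point`): the negative of an affine point `(x, y)`
is `(x, −y − a₁x − a₃) = (x, y + 1) ≠ (x, y)` (Silverman III.2.3), so no point has order `2`, and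
a finite abelian group of even order has one (Cauchy). [cite: SilvermanAEC2009, III.2.3 and V.4
(first paragraph, PDF p. 135), Exercise 5.7] -/
theorem odd_natCard_point_of_a₁_eq_zero_of_a₃_eq_one (E : WeierstrassCurve (ZMod 2))
    [Finite E.toAffine.Point] (h1 : E.a₁ = 0) (h3 : E.a₃ = 1) :
    Odd (Nat.card E.toAffine.Point) := by
  by_contra hodd
  rw [Nat.not_odd_iff_even, even_iff_two_dvd] at hodd
  obtain ⟨P, hP⟩ := exists_prime_addOrderOf_dvd_card' (G := E.toAffine.Point) 2 hodd
  rw [addOrderOf_eq_prime_iff, two_nsmul, add_eq_zero_iff_eq_neg] at hP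
  obtain ⟨hPP, hP0⟩ := hP
  rcases P with _ | ⟨x, y, h⟩
  · exact hP0 rfl
  · rw [Affine.Point.neg_some, Affine.Point.some.injEq] at hPP
    have hy : y = -y - E.a₁ * x - E.a₃ := hPP.2
    rw [h1, h3] at hy
    exact ne_negY_aux x y hy

variable (W : WeierstrassCurve ℚ) [W.IsGloballyMinimal]

/-- **`a₁` even and `a₃` odd ⟹ `#W̃(𝔽₂)` odd** for the reduction modulo `2` of a globally
minimal equation (`reductionPointCount`; the reduced equation has `ā₁ = 0`, `ā₃ = 1`).
[cite: SilvermanAEC2009, III.2.3 and Exercise 5.7] -/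
theorem odd_reductionPointCount_two_of_even_a₁_of_odd_a₃ (ha₁ : Even (integralModelInt W).a₁)
    (ha₃ : Odd (integralModelInt W).a₃) : Odd (W.reductionPointCount 2) := by
  rw [WeierstrassCurve.reductionPointCount]
  refine odd_natCard_point_of_a₁_eq_zero_of_a₃_eq_one _ ?_ ?_
  · rw [map_a₁, eq_intCast]
    exact (ZMod.intCast_zmod_eq_zero_iff_dvd _ 2).mpr (by exact_mod_cast even_iff_two_dvd.mp ha₁)
  · rw [map_a₃, eq_intCast]
    obtain ⟨k, hk⟩ := ha₃
    rw [hk]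
    push_cast
    rw [show (2 : ZMod 2) = 0 from rfl, zero_mul, zero_add]

/-- **`a₁` even and `a₃` odd ⟹ the trace of Frobenius at `2` is even** (`3 − #W̃(𝔽₂)`).
[cite: SilvermanAEC2009, Exercise 5.10(a) and Exercise 5.7] -/
theorem even_frobeniusTrace_two_of_even_a₁_of_odd_a₃ (ha₁ : Even (integralModelInt W).a₁)
    (ha₃ : Odd (integralModelInt W).a₃) : Even (W.frobeniusTrace 2) := by
  obtain ⟨k, hk⟩ := odd_reductionPointCount_two_of_even_a₁_of_odd_a₃ W ha₁ ha₃
  refine ⟨1 - k, ?_⟩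
  rw [WeierstrassCurve.frobeniusTrace, hk]
  push_cast
  ring

/-- **Good reduction at `2` and `a₂` odd ⟹ `a₁` odd** (trace form): on a globally minimal equation
with good reduction at `2`, `a₁` or `a₃` is odd (`odd_a₁_or_odd_a₃_of_semistableAtTwo`), and
`a₁` even, `a₃` odd would make the trace even. Equivalently: `W mod 2` ordinary ⟹ `ā₁ ≠ 0`
(Silverman V.4, Exercise 5.7: in characteristic `2`, supersingular iff `j = ā₁¹²/Δ̄ = 0`).
[cite: SilvermanAEC2009, V.4 (first paragraph, PDF p. 135), Exercises 5.7 and 5.10(a)] -/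
theorem odd_a₁_of_hasGoodReductionAtPrime_two_of_odd_frobeniusTrace_two [W.IsElliptic]
    (hgood : W.HasGoodReductionAtPrime 2) (hodd : Odd (W.frobeniusTrace 2)) :
    Odd (integralModelInt W).a₁ := by
  rcases Int.even_or_odd (integralModelInt W).a₁ with he | ho
  · exact absurd (even_frobeniusTrace_two_of_even_a₁_of_odd_a₃ W he
      ((odd_a₁_or_odd_a₃_of_semistableAtTwo W (Or.inl hgood)).resolve_left
        (Int.not_odd_iff_even.mpr he))) (Int.not_even_iff_odd.mpr hodd)
  · exact ho

/-- **Good reduction at `2` and `a₂(W) = (L(W, s))₂` odd ⟹ `a₁` of the minimal equation is odd**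
(`LFunction_apply_prime_eq_frobeniusTrace`: `a₂ = 3 − #W̃(𝔽₂)` at a good prime).
[cite: SilvermanAEC2009, Exercise 8.19(a) and Exercise 5.7] -/
theorem odd_a₁_of_hasGoodReductionAtPrime_two_of_odd_LFunction_two [W.IsElliptic]
    (hgood : W.HasGoodReductionAtPrime 2) (hodd : Odd (W.LFunction 2)) :
    Odd (integralModelInt W).a₁ := by
  rw [LFunction_apply_prime_eq_frobeniusTrace W 2 hgood] at hodd
  exact odd_a₁_of_hasGoodReductionAtPrime_two_of_odd_frobeniusTrace_two W hgood hodd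

end CharTwo

/-! ### 2. `W^{(4d)}` is globally minimal in every case `η = 1` -/

section MinimalEtaOne

variable (W : WeierstrassCurve ℚ) [W.IsElliptic] [W.IsGloballyMinimal]

/-- **`W^{(4d)}`, `d ∈ {−1, 2, −2}`, is GLOBALLY MINIMAL for `W` good at `2` with `a₂(W)` odd**
(good ordinary at `2`): `a₁` is odd (`odd_a₁_of_hasGoodReductionAtPrime_two_of_odd_LFunction_two`)
and `isGloballyMinimal_quadraticTwist_four_mul_of_odd_a₁` applies (Connell / Pal 2012 Prop. 2.4,
signature `0,0,c`). [cite: Pal2012, Prop. 2.4 (Connell), case p = 2]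
[cite: Stevens1989, Lemma (5.2) p. 96] -/
theorem isGloballyMinimal_quadraticTwist_four_mul_of_odd_LFunction_two {d : ℤ}
    (hd : d = -1 ∨ d = 2 ∨ d = -2) (hgood : W.HasGoodReductionAtPrime 2)
    (hodd : Odd (W.LFunction 2)) : (W.quadraticTwist (4 * (d : ℚ))).IsGloballyMinimal :=
  isGloballyMinimal_quadraticTwist_four_mul_of_odd_a₁ W hd
    (odd_a₁_of_hasGoodReductionAtPrime_two_of_odd_LFunction_two W hgood hodd)

/-- **`W^{(4d)}`, `d ∈ {−1, 2, −2}`, is GLOBALLY MINIMAL in every case `η = 1` of Stevens 1989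
Lemma (5.2)**: `W` globally minimal, good or multiplicative at `2`, and `d = −1`, or `W`
multiplicative at `2`, or `a₂(W)` odd (for `W` good at `2`: ordinary). The excluded case — `d = ±2`,
`W` good at `2` with `a₂(W)` even (supersingular) — is Stevens' `η = 2`.
[cite: Stevens1989, Lemma (5.2) p. 96] [cite: Pal2012, Prop. 2.4 (Connell), case p = 2] -/
theorem isGloballyMinimal_quadraticTwist_four_mul_of_etaOne {d : ℤ} (hd : d = -1 ∨ d = 2 ∨ d = -2)
    (hsemi : W.HasGoodReductionAtPrime 2 ∨ W.HasMultiplicativeReductionAtPrime 2)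
    (hη : d = -1 ∨ W.HasMultiplicativeReductionAtPrime 2 ∨ Odd (W.LFunction 2)) :
    (W.quadraticTwist (4 * (d : ℚ))).IsGloballyMinimal := by
  rcases hη with h | h | h
  · exact isGloballyMinimal_quadraticTwist_four_mul W hd hsemi (Or.inl h)
  · exact isGloballyMinimal_quadraticTwist_four_mul W hd hsemi (Or.inr h)
  · rcases hsemi with hg | hm
    · exact isGloballyMinimal_quadraticTwist_four_mul_of_odd_LFunction_two W hd hg h
    · exact isGloballyMinimal_quadraticTwist_four_mul W hd (Or.inr hm) (Or.inr hm)

end MinimalEtaOne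

end Literature.NumberTheory.EllipticCurves

namespace Literature.NumberTheory.EllipticCurves.ModularForms

/-! ### 3. `Λ(W ⊗ χ) = g(χ)⁻¹ Λ(W)` from the minimality of `W^{(4d)}`; every case `η = 1` -/

section Stevens

variable {W : WeierstrassCurve ℚ} [W.IsElliptic]

/-- **The Néron lattice of the twist from the minimality of `W^{(4d)}` alone**: if the equation
`T = W.quadraticTwist (4d)` (`d ≠ 0`) is globally minimal, `L` is a Néron-type pair of `W`, `C` any
globally minimal model of `W.quadraticTwist d` with Néron-type pair `L'`, and `s² = 4d`, then
`z ∈ Λ(C) ↔ s z ∈ Λ(W)` (`T` has Néron pair `s⁻¹ L` by `isNeronLatticeOf_quadraticTwist_of_sq_eq`,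
and `C = w • T` with `w.u = ±1` by `isGloballyMinimal_unique_holds`). The proof of
`neronLattice_quadraticTwist_two`, with its minimality input abstracted.
[cite: Stevens1989, Lemma (5.2) p. 96] [cite: Pal2012, Lemma 3.1 and Prop. 2.5]
[cite: SilvermanAEC2009, VII.1 Prop. 1.3(b), VIII.8.3] -/
theorem neronLattice_quadraticTwist_two_of_isGloballyMinimal {L : PeriodPair}
    (hL : IsNeronLatticeOf (W.baseChange ℂ) L) {d : ℤ} (hdZ : d ≠ 0)
    (hTmin : (W.quadraticTwist (4 * (d : ℚ))).IsGloballyMinimal)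
    (C : WeierstrassCurve ℚ) [C.IsElliptic] [C.IsGloballyMinimal]
    (hCtw : ∃ u : VariableChange ℚ, u • W.quadraticTwist (d : ℚ) = C) {L' : PeriodPair}
    (hL' : IsNeronLatticeOf (C.baseChange ℂ) L') {s : ℂ} (hs : s ^ 2 = ((4 * d : ℤ) : ℂ)) (z : ℂ) :
    z ∈ L'.lattice ↔ s * z ∈ L.lattice := by
  have hd0 : (d : ℚ) ≠ 0 := by exact_mod_cast hdZ
  have hs0 : s ≠ 0 := by
    rintro rfl
    have h0 : ((4 * d : ℤ) : ℂ) = 0 := by rw [← hs]; simp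
    have h4d : (4 * d : ℤ) ≠ 0 := mul_ne_zero (by norm_num) hdZ
    exact h4d (by exact_mod_cast h0)
  -- the globally minimal twisted equation `T`, with Néron pair `s⁻¹ L`
  set T : WeierstrassCurve ℚ := W.quadraticTwist (4 * (d : ℚ)) with hT
  haveI : T.IsGloballyMinimal := hTmin
  have hLT : IsNeronLatticeOf (T.baseChange ℂ) (L.mulLeft s⁻¹ (inv_ne_zero hs0)) :=
    isNeronLatticeOf_quadraticTwist_of_sq_eq (4 * (d : ℚ)) hL hs0 (by rw [hs]; push_cast; ring)
  -- `C = w • T`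
  obtain ⟨u, hu⟩ := hCtw
  obtain ⟨E, hE⟩ := W.exists_variableChange_quadraticTwist_mul_sq (d : ℚ) 2 two_ne_zero
  have hET : E • W.quadraticTwist (d : ℚ) = T := by rw [hE, hT]; congr 1; ring
  have hCw : C = (u * E⁻¹) • T := by rw [mul_smul, ← hET, inv_smul_smul, hu]
  haveI : (W.quadraticTwist (d : ℚ)).IsElliptic := W.isElliptic_quadraticTwist hd0
  haveI : T.IsElliptic := by rw [← hET]; infer_instance
  haveI : ((u * E⁻¹) • T).IsGloballyMinimal := by rw [← hCw]; infer_instance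
  -- `u = ±1`
  have hu1 : (u * E⁻¹).u = 1 ∨ (u * E⁻¹).u = -1 := (isGloballyMinimal_unique_holds T (u * E⁻¹)).1
  -- `Λ(C) = u · s⁻¹ Λ(W)`
  have hL'T : IsNeronLatticeOf (((u * E⁻¹) • T).baseChange ℂ) L' := by rw [← hCw]; exact hL'
  have hΛ := IsNeronLatticeOf.lattice_eq_mulLeft_of_smul (u * E⁻¹) hLT hL'T
  rw [hΛ, PeriodPair.mem_mulLeft_lattice, PeriodPair.mem_mulLeft_lattice, inv_inv, ← mul_assoc]
  rcases hu1 with h1 | h1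
  · rw [h1]; simp
  · rw [h1]
    simp only [Units.val_neg, Units.val_one, Rat.cast_neg, Rat.cast_one, inv_neg, inv_one,
      mul_neg, mul_one, neg_mul]
    exact neg_mem_iff

/-- **Stevens 1989, Lemma (5.2), for `χ ∈ {χ₋₄, χ₈, χ₋₈}` in EVERY case `η = 1` — PROVED.** `W/ℚ`
globally minimal, good or multiplicative at `2`; `d ∈ {−1, 2, −2}` with `d = −1`, or `W`
multiplicative at `2`, or `a₂(W)` odd; `C` any globally minimal model of `W.quadraticTwist d` with
Néron-type pair `L'`; `s² = 4d` (`= g(χ)²`). Then `z ∈ Λ(C) ↔ s z ∈ Λ(W)`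
("`ℒ(A^ψ) = (η/τ(ψ)) ℒ(A)`, `η = 1` unless `8 ∣ cond ψ` and `A` good supersingular at `2`").
[cite: Stevens1989, Lemma (5.2) p. 96] [cite: Pal2012, Prop. 2.4 (Connell), case p = 2] -/
theorem neronLattice_quadraticTwist_two_of_etaOne [W.IsGloballyMinimal] {L : PeriodPair}
    (hL : IsNeronLatticeOf (W.baseChange ℂ) L) {d : ℤ} (hd : d = -1 ∨ d = 2 ∨ d = -2)
    (hsemi : W.HasGoodReductionAtPrime 2 ∨ W.HasMultiplicativeReductionAtPrime 2)
    (hη : d = -1 ∨ W.HasMultiplicativeReductionAtPrime 2 ∨ Odd (W.LFunction 2))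
    (C : WeierstrassCurve ℚ) [C.IsElliptic] [C.IsGloballyMinimal]
    (hCtw : ∃ u : VariableChange ℚ, u • W.quadraticTwist (d : ℚ) = C) {L' : PeriodPair}
    (hL' : IsNeronLatticeOf (C.baseChange ℂ) L') {s : ℂ} (hs : s ^ 2 = ((4 * d : ℤ) : ℂ)) (z : ℂ) :
    z ∈ L'.lattice ↔ s * z ∈ L.lattice :=
  neronLattice_quadraticTwist_two_of_isGloballyMinimal hL
    (by rcases hd with rfl | rfl | rfl <;> norm_num)
    (isGloballyMinimal_quadraticTwist_four_mul_of_etaOne W hd hsemi hη) C hCtw hL' hs z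

end Stevens

/-! ### 4. `2 ∤ c₀(𝒜)` for `𝒜 = 𝒜' ⊗ χ`, `𝒜'` semistable at `2`, in every case `η = 1` -/

section Manin

variable {W : WeierstrassCurve ℚ} [W.IsElliptic]
  {W' : WeierstrassCurve ℚ} [W'.IsElliptic] [W'.IsGloballyMinimal]

/-- The core of the per-pair certificate at `2` in every case `η = 1`, for a given primitive
quadratic character `χ` mod `m` with `g(χ)² = 4d`, `m² ∣ N(W)`, carrying the odd-`n` twisting
identity and vanishing at even `n` (cf. `not_dvd_maninConstant_of_isTwistOfSemistableAtTwo_gamma0_of_char`,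
whose clause `d = −1 ∨ 2 ∣ N(W')` is widened by `∨ a₂(W')` odd). [cite: Stevens1989, Lemmas (5.2), (5.4)]
[cite: Cesnavicius2018, Thm. 1.2] -/
theorem not_dvd_maninConstant_of_isTwistOfSemistableAtTwo_etaOne_gamma0_of_char
    (hM : mazur_not_dvd_maninConstant_of_odd)
    (hAU : abbesUllmo_not_dvd_maninConstant_of_not_dvd_level)
    (hC2 : cesnavicius_not_two_dvd_maninConstant_of_two_dvd_level) (hnf : exists_isNewformOf)
    {d : ℤ} (hd : d = -1 ∨ d = 2 ∨ d = -2)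
    {m : ℕ} [NeZero m] {χ : DirichletCharacter ℂ m} (hχq : χ.IsQuadratic) (hχp : χ.IsPrimitive)
    (hG : gaussSum χ (ZMod.stdAddChar (N := m)) ^ 2 = ((4 * d : ℤ) : ℂ))
    (hχodd : ∀ n : ℕ, ¬ 2 ∣ n →
      (((W'.quadraticTwist (d : ℚ)).LFunction n : ℤ) : ℂ) = χ n * ((W'.LFunction n : ℤ) : ℂ))
    (hχeven : ∀ n : ℕ, 2 ∣ n → χ n = 0)
    (htw : IsIsogenous W (W'.quadraticTwist (d : ℚ)))
    (hN'N : W'.conductorNorm ℤ ∣ W.conductorNorm ℤ) (hmN : m ^ 2 ∣ W.conductorNorm ℤ)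
    (h4N' : ¬ 2 ^ 2 ∣ W'.conductorNorm ℤ)
    (hη : d = -1 ∨ 2 ∣ W'.conductorNorm ℤ ∨ Odd (W'.LFunction 2))
    (hadd : ¬ W.HasGoodReductionAtPrime 2 ∧ ¬ W.HasMultiplicativeReductionAtPrime 2)
    (W₀ : WeierstrassCurve ℚ) [W₀.IsElliptic] [W₀.IsGloballyMinimal] {N₀ : ℕ} [NeZero N₀]
    (D₀ : ModularParametrizationData W₀ N₀) (hiso : IsIsogenous W W₀)
    (h₀ : ∀ z ∈ D₀.L.lattice, ∃ w ∈ periodLattice D₀.f, z = D₀.c * w) :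
    ¬ (2 : ℤ) ∣ D₀.maninConstant := by
  have hdZ : d ≠ 0 := by rcases hd with rfl | rfl | rfl <;> norm_num
  have hd0 : (d : ℚ) ≠ 0 := by exact_mod_cast hdZ
  -- the levels are the conductors
  have hLW₀ : W.LFunction = W₀.LFunction := LFunction_eq_of_isIsogenous_holds W W₀ hiso
  have hnfW : IsNewformOf W D₀.f :=
    ⟨D₀.isNewformOf.1, fun n ↦ by rw [D₀.isNewformOf.2 n, hLW₀]⟩
  have hN₀ : N₀ = W.conductorNorm ℤ :=
    IsNewformOf.level_eq_conductorNorm_of_exists_isNewformOf hnf hnfW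
  haveI : NeZero (W'.conductorNorm ℤ) := ⟨(conductorNorm_pos_holds W').ne'⟩
  -- the optimal `X₀`-datum `D'` of `𝒜'`, on a globally minimal `W₁' ∼ W'`
  obtain ⟨f', hf'⟩ := hnf W'
  obtain ⟨W₁', hE₁', hM₁', D', hD'f, hiso₁, hmin⟩ :=
    exists_optimal_modularParametrizationData_of_isNewformOf' (W'.conductorNorm ℤ) W' rfl hf'
  haveI := hE₁'
  haveI := hM₁'
  have hopt' : ∀ z ∈ D'.L.lattice, ∃ w ∈ periodLattice D'.f, z = D'.c * w :=
    D'.latticeEq_of_forall_modularDegree_le fun W₂ _ D₂ h2 ↦ hmin W₂ D₂ (h2.trans hD'f)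
  -- `W₁'` is semistable at `2` (its conductor is the level `N(W')`, `4 ∤ N(W')`),
  -- multiplicative there when `2 ∣ N(W')`, and `a₂(W₁') = a₂(W')`
  have hN'₁ : W'.conductorNorm ℤ = W₁'.conductorNorm ℤ :=
    IsNewformOf.level_eq_conductorNorm_of_exists_isNewformOf hnf D'.isNewformOf
  have hsemi : W₁'.HasGoodReductionAtPrime 2 ∨ W₁'.HasMultiplicativeReductionAtPrime 2 :=
    hasGoodReductionAtPrime_or_hasMultiplicativeReductionAtPrime_of_not_sq_dvd_conductorNorm
      (by rw [← hN'₁]; exact h4N')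
  have hη₁ : d = -1 ∨ W₁'.HasMultiplicativeReductionAtPrime 2 ∨ Odd (W₁'.LFunction 2) := by
    rcases hη with h | h2N | hodd
    · exact Or.inl h
    · right
      rcases hsemi with hg | hm'
      · -- good at `2` would give `f₂ = 0`, contradicting `2 ∣ N(W₁')`
        exfalso
        set v2 : HeightOneSpectrum ℤ := (primesEquiv (R := ℤ)).symm ⟨2, Nat.prime_two⟩ with hv2
        have hg' : W₁'.HasGoodReductionAt v2 :=
          (W₁'.hasGoodReductionAtPrime_iff_hasGoodReductionAt_holds ⟨2, Nat.prime_two⟩).mp hg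
        have hf0 : W₁'.conductorExponent v2 = 0 := (conductorExponent_eq_zero_iff_holds v2 W₁').mpr hg'
        have hfac : (W₁'.conductorNorm ℤ).factorization 2 = 0 := by
          rw [show (2 : ℕ) = ((⟨2, Nat.prime_two⟩ : Nat.Primes) : ℕ) from rfl,
            factorization_conductorNorm_primesEquiv_symm W₁' ⟨2, Nat.prime_two⟩, ← hv2, hf0]
        rw [hN'₁] at h2N
        have := (Nat.prime_two.dvd_iff_one_le_factorization (conductorNorm_pos_holds W₁').ne').mp h2N
        omega
      · exact Or.inl hm'
    · right; right
      rwa [LFunction_eq_of_isIsogenous_holds W' W₁' hiso₁] at hodd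
  -- the minimal model `C` of `W₁' ⊗ χ` and a Néron pair of it
  haveI : (W₁'.quadraticTwist (d : ℚ)).IsElliptic := W₁'.isElliptic_quadraticTwist hd0
  obtain ⟨vC, hvC⟩ := hasGlobalMinimalModel_rat_holds (W₁'.quadraticTwist (d : ℚ))
  haveI := hvC
  haveI : ((vC • W₁'.quadraticTwist (d : ℚ)).baseChange ℂ).IsElliptic := by
    rw [WeierstrassCurve.baseChange]; infer_instance
  obtain ⟨LC, hC⟩ := exists_isNeronLatticeOf_holds ((vC • W₁'.quadraticTwist (d : ℚ)).baseChange ℂ)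
  -- Stevens (5.2) at `2`, `η = 1`: `Λ_C = g(χ)⁻¹ Λ_{W₁'}`
  have hLC : ∀ z : ℂ, z ∈ LC.lattice ↔ gaussSum χ (ZMod.stdAddChar (N := m)) * z ∈ D'.L.lattice :=
    fun z ↦ neronLattice_quadraticTwist_two_of_etaOne D'.isNeronLattice hd hsemi hη₁
      (vC • W₁'.quadraticTwist (d : ℚ)) ⟨vC, rfl⟩ hC hG z
  -- the newform of `𝒜` is the `χ`-twist of that of `𝒜'`
  have hLtw : W.LFunction = (W'.quadraticTwist (d : ℚ)).LFunction := by
    haveI : (W'.quadraticTwist (d : ℚ)).IsElliptic := W'.isElliptic_quadraticTwist hd0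
    exact LFunction_eq_of_isIsogenous_holds _ _ htw
  have hf : ∀ n : ℕ, cuspCoeff D₀.f n = χ n * cuspCoeff D'.f n := by
    intro n
    have hLn : W₀.LFunction n = W.LFunction n := by rw [hLW₀]
    rw [D₀.isNewformOf.2 n, hD'f, hf'.2 n, hLn]
    by_cases h2n : 2 ∣ n
    · have h0 : W.LFunction n = 0 :=
        W.LFunction_apply_eq_zero_of_not_good_of_not_mult 2 hadd.1 hadd.2 h2n
      rw [h0, hχeven n h2n]
      simp
    · have hLn' : W.LFunction n = (W'.quadraticTwist (d : ℚ)).LFunction n := by rw [hLtw]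
      rw [hLn', hχodd n h2n]
  -- conductor bookkeeping at level `N₀ = N(W)`
  have hN : W'.conductorNorm ℤ ∣ N₀ := by rw [hN₀]; exact hN'N
  have hm : m ^ 2 ∣ N₀ := by rw [hN₀]; exact hmN
  exact not_dvd_maninConstant_of_charTwist_gamma0_of_not_sq_dvd_level hM hAU hC2 D₀ h₀ D' hopt'
    hχq hχp hN hm hf hC hLC Nat.prime_two h4N'

/-- **`2 ∤ c₀(𝒜)` for `𝒜 = 𝒜' ⊗ ℚ(√d)`, `d ∈ {−1, 2, −2}`, `𝒜'` semistable at `2`, in EVERY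
case `η = 1` of Stevens' Lemma (5.2): `d = −1`, or `𝒜'` multiplicative at `2`, or `a₂(𝒜')` odd
(`𝒜'` good ordinary at `2`)** — `Γ₀` road, binders `hM hAU hC2 hnf` ONLY. Displayed hypotheses:
`W ∈ 𝒜` (any model), `W' ∈ 𝒜'` globally minimal, `W ∼ W'.quadraticTwist d`; `N(W') ∣ N(W)`;
`(4|d|)² ∣ N(W)`; `4 ∤ N(W')`; `d = −1 ∨ 2 ∣ N(W') ∨ a₂(W')` odd (`a₂ = W'.LFunction 2`, an
isogeny invariant); `W` additive at `2`. Conclusion: every lattice-optimal `X₀`-datum `D₀` of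
every globally minimal `W₀ ∼ W` has `2 ∤ D₀.maninConstant`. The only case NOT covered at `2` for a
twist of a semistable class is `η = 2` (`d = ±2`, `𝒜'` good supersingular at `2`: `a₂` even),
where Stevens' lemma gives `c₀ ∣ 2 c(D')` only.
[cite: Stevens1989, Lemmas (5.2), (5.4) pp. 96–97] [cite: Cesnavicius2018, Thm. 1.2]
[cite: Mazur1978, Cor. 4.1] [cite: AbbesUllmo1996, Thm. A]
[cite: SilvermanAEC2009, V.4 and Exercise 5.7] -/
theorem not_dvd_maninConstant_of_isTwistOfSemistableAtTwo_etaOne_gamma0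
    (hM : mazur_not_dvd_maninConstant_of_odd)
    (hAU : abbesUllmo_not_dvd_maninConstant_of_not_dvd_level)
    (hC2 : cesnavicius_not_two_dvd_maninConstant_of_two_dvd_level) (hnf : exists_isNewformOf)
    {d : ℤ} (hd : d = -1 ∨ d = 2 ∨ d = -2)
    (htw : IsIsogenous W (W'.quadraticTwist (d : ℚ)))
    (hN'N : W'.conductorNorm ℤ ∣ W.conductorNorm ℤ)
    (hmN : (4 * d.natAbs) ^ 2 ∣ W.conductorNorm ℤ)
    (h4N' : ¬ 2 ^ 2 ∣ W'.conductorNorm ℤ)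
    (hη : d = -1 ∨ 2 ∣ W'.conductorNorm ℤ ∨ Odd (W'.LFunction 2))
    (hadd : ¬ W.HasGoodReductionAtPrime 2 ∧ ¬ W.HasMultiplicativeReductionAtPrime 2)
    (W₀ : WeierstrassCurve ℚ) [W₀.IsElliptic] [W₀.IsGloballyMinimal] {N₀ : ℕ} [NeZero N₀]
    (D₀ : ModularParametrizationData W₀ N₀) (hiso : IsIsogenous W W₀)
    (h₀ : ∀ z ∈ D₀.L.lattice, ∃ w ∈ periodLattice D₀.f, z = D₀.c * w) :
    ¬ (2 : ℤ) ∣ D₀.maninConstant := by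
  rcases hd with rfl | rfl | rfl
  · -- `χ₋₄`
    refine not_dvd_maninConstant_of_isTwistOfSemistableAtTwo_etaOne_gamma0_of_char hM hAU hC2 hnf
      (Or.inl rfl) isQuadratic_χ₄_ringHomComp isPrimitive_χ₄_ringHomComp
      (by rw [gaussSum_χ₄_ringHomComp_sq]; norm_num) (fun n hn ↦ ?_) (fun n hn ↦ ?_) htw hN'N
      (by simpa using hmN) h4N' hη hadd W₀ D₀ hiso h₀
    · rw [show ((-1 : ℤ) : ℚ) = -1 by norm_num, W'.LFunction_quadraticTwist_neg_one_apply_of_odd hn,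
        Int.cast_mul, χ₄_ringHomComp_apply_natCast]
    · rw [χ₄_ringHomComp_apply_natCast, ZMod.χ₄_nat_eq_if_mod_four, if_pos (Nat.mod_eq_zero_of_dvd hn)]
      simp
  · -- `χ₈`
    refine not_dvd_maninConstant_of_isTwistOfSemistableAtTwo_etaOne_gamma0_of_char hM hAU hC2 hnf
      (Or.inr (Or.inl rfl)) isQuadratic_χ₈_ringHomComp isPrimitive_χ₈_ringHomComp
      (by rw [gaussSum_χ₈_ringHomComp_sq]; norm_num) (fun n hn ↦ ?_) (fun n hn ↦ ?_) htw hN'N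
      (by simpa using hmN) h4N' hη hadd W₀ D₀ hiso h₀
    · rw [show ((2 : ℤ) : ℚ) = 2 by norm_num, W'.LFunction_quadraticTwist_two_apply_of_odd hn,
        Int.cast_mul, χ₈_ringHomComp_apply_natCast]
    · rw [χ₈_ringHomComp_apply_natCast, ZMod.χ₈_nat_eq_if_mod_eight,
        if_pos ((Nat.mod_eq_zero_of_dvd hn))]
      simp
  · -- `χ₋₈`
    refine not_dvd_maninConstant_of_isTwistOfSemistableAtTwo_etaOne_gamma0_of_char hM hAU hC2 hnf
      (Or.inr (Or.inr rfl)) isQuadratic_χ₈'_ringHomComp isPrimitive_χ₈'_ringHomComp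
      (by rw [gaussSum_χ₈'_ringHomComp_sq]; norm_num) (fun n hn ↦ ?_) (fun n hn ↦ ?_) htw hN'N
      (by simpa using hmN) h4N' hη hadd W₀ D₀ hiso h₀
    · rw [show ((-2 : ℤ) : ℚ) = -2 by norm_num, W'.LFunction_quadraticTwist_neg_two_apply_of_odd hn,
        Int.cast_mul, χ₈'_ringHomComp_apply_natCast]
    · rw [χ₈'_ringHomComp_apply_natCast, ZMod.χ₈'_nat_eq_if_mod_eight,
        if_pos ((Nat.mod_eq_zero_of_dvd hn))]
      simp

end Manin

/-! ### 5. The class certificate with the widened disjunct at `2` (every case `η = 1`) -/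

section ClassCertificate

/-- **Per member, from a displayed witness at `2` in any case `η = 1`**: a parameter
`d ∈ {−1, 2, −2}`, a globally minimal elliptic `V` with `W' ∼ V.quadraticTwist d`, `N(V) ∣ N(W')`,
`(4|d|)² ∣ N(W')`, `4 ∤ N(V)`, `d = −1 ∨ 2 ∣ N(V) ∨ a₂(V)` odd, and `W'` additive at `2`, give
`2 ∤ D'.maninConstant` for every lattice-optimal `X₀`-datum `D'` of the globally minimal `W'`
(binders `hM hAU hC2 hnf`). [cite: Stevens1989, Lemmas (5.2), (5.4)] [cite: Cesnavicius2018, Thm. 1.2] -/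
theorem not_dvd_maninConstant_of_exists_twistAtTwo_etaOne_gamma0
    (hM : mazur_not_dvd_maninConstant_of_odd)
    (hAU : abbesUllmo_not_dvd_maninConstant_of_not_dvd_level)
    (hC2 : cesnavicius_not_two_dvd_maninConstant_of_two_dvd_level) (hnf : exists_isNewformOf)
    (W' : WeierstrassCurve ℚ) [W'.IsElliptic] [W'.IsGloballyMinimal] {N' : ℕ} [NeZero N']
    (D' : ModularParametrizationData W' N')
    (hopt : ∀ z ∈ D'.L.lattice, ∃ w ∈ periodLattice D'.f, z = D'.c * w)
    (htw : ∃ (d : ℤ) (V : WeierstrassCurve ℚ) (_ : V.IsElliptic) (_ : V.IsGloballyMinimal),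
      (d = -1 ∨ d = 2 ∨ d = -2) ∧ IsIsogenous W' (V.quadraticTwist (d : ℚ)) ∧
      V.conductorNorm ℤ ∣ W'.conductorNorm ℤ ∧ (4 * d.natAbs) ^ 2 ∣ W'.conductorNorm ℤ ∧
      ¬ 2 ^ 2 ∣ V.conductorNorm ℤ ∧ (d = -1 ∨ 2 ∣ V.conductorNorm ℤ ∨ Odd (V.LFunction 2)) ∧
      (¬ W'.HasGoodReductionAtPrime 2 ∧ ¬ W'.HasMultiplicativeReductionAtPrime 2)) :
    ¬ (2 : ℤ) ∣ D'.maninConstant := by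
  obtain ⟨d, V, hVE, hVM, hd, hiso, hdvd, hm, h4, hη, hadd⟩ := htw
  haveI := hVE
  haveI := hVM
  exact not_dvd_maninConstant_of_isTwistOfSemistableAtTwo_etaOne_gamma0 hM hAU hC2 hnf hd hiso hdvd
    hm h4 hη hadd W' D' (IsIsogenous.refl_holds W') hopt

/-- **Edixhoven 1991 Thm. 3, OR the odd twist road, OR the twist road at `2` in any case `η = 1`,
at each square prime; Česnavičius 2018 Thm. 1.2 at the others — per class, `Γ₀` road, binders
`hM hAU hC hEA hEB hnf`, the disjunct at `2` spelled out.** If at every square prime `p` of every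
globally minimal member `W'` of the class of `W` either `p > 7` and `EdixhovenNonexceptionalAt W' p`,
or `TwistSemistableWitnessAt W' p`, or `p = 2` with a displayed witness (`d`, `V`, `N(V) ∣ N(W')`,
`(4|d|)² ∣ N(W')`, `4 ∤ N(V)`, `d = −1 ∨ 2 ∣ N(V) ∨ a₂(V)` odd, `W'` additive at `2`), then
`ClassAbsManinConstantEqOne W`. [cite: EdixhovenManin1991, §1 and Thm. 3]
[cite: Cesnavicius2018, Thm. 1.2] [cite: Stevens1989, Lemmas (5.2), (5.4)]
[cite: Mazur1978, Cor. 4.1] [cite: AbbesUllmo1996, Thm. A] -/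
theorem classAbsManinConstantEqOne_of_forall_sq_prime_edixhoven_or_twist_or_twistAtTwo_gamma0
    (hM : mazur_not_dvd_maninConstant_of_odd)
    (hAU : abbesUllmo_not_dvd_maninConstant_of_not_dvd_level)
    (hC : cesnavicius_not_two_dvd_maninConstant_of_two_dvd_level)
    (hEA : edixhoven_not_dvd_maninConstant_of_not_potentiallyGoodOrdinary)
    (hEB : edixhoven_not_dvd_maninConstant_of_kodairaSymbol_ne)
    (hnf : exists_isNewformOf) (W : WeierstrassCurve ℚ)
    (hcov : ∀ (W' : WeierstrassCurve ℚ) [W'.IsElliptic] [W'.IsGloballyMinimal], IsIsogenous W W' →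
      ∀ (p : ℕ) (hp : p.Prime), p ^ 2 ∣ W'.conductorNorm ℤ →
        (7 < p ∧ EdixhovenNonexceptionalAt W' p hp) ∨ @TwistSemistableWitnessAt W' p ⟨hp⟩ ∨
          (p = 2 ∧ ∃ (d : ℤ) (V : WeierstrassCurve ℚ) (_ : V.IsElliptic) (_ : V.IsGloballyMinimal),
            (d = -1 ∨ d = 2 ∨ d = -2) ∧ IsIsogenous W' (V.quadraticTwist (d : ℚ)) ∧
            V.conductorNorm ℤ ∣ W'.conductorNorm ℤ ∧ (4 * d.natAbs) ^ 2 ∣ W'.conductorNorm ℤ ∧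
            ¬ 2 ^ 2 ∣ V.conductorNorm ℤ ∧ (d = -1 ∨ 2 ∣ V.conductorNorm ℤ ∨ Odd (V.LFunction 2)) ∧
            (¬ W'.HasGoodReductionAtPrime 2 ∧ ¬ W'.HasMultiplicativeReductionAtPrime 2))) :
    ClassAbsManinConstantEqOne W := by
  intro W' _ _ N' _ D' hiso hopt
  have hN' : N' = W'.conductorNorm ℤ :=
    IsNewformOf.level_eq_conductorNorm_of_exists_isNewformOf hnf D'.isNewformOf
  subst hN'
  refine D'.abs_maninConstant_eq_one_of_forall_prime_not_dvd fun p hp ↦ ?_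
  by_cases hsq : p ^ 2 ∣ W'.conductorNorm ℤ
  · rcases hcov W' hiso p hp hsq with ⟨h7, hne | hG⟩ | htw | ⟨rfl, htw2⟩
    · exact hEB W' D' hopt p hp h7 hne.1 hne.2.1 hne.2.2
    · exact hEA W' D' hopt p hp h7 hG
    · haveI : Fact p.Prime := ⟨hp⟩
      exact not_dvd_maninConstant_of_twistSemistableWitnessAt_gamma0 hM hAU hC hnf W' D' hopt htw
    · exact_mod_cast
        not_dvd_maninConstant_of_exists_twistAtTwo_etaOne_gamma0 hM hAU hC hnf W' D' hopt htw2
  · exact cesnavicius2018_not_dvd_maninConstant_of_not_sq_dvd_level hM hAU hC W' D' hopt hp hsq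

/-- The binder form carried by consumers: for a class covered as in
`classAbsManinConstantEqOne_of_forall_sq_prime_edixhoven_or_twist_or_twistAtTwo_gamma0`, `p ∤ c`
for EVERY prime `p` and every optimal datum of every globally minimal member.
[cite: EdixhovenManin1991, §1 and Thm. 3] [cite: Cesnavicius2018, Thm. 1.2] -/
theorem not_dvd_maninConstant_of_forall_sq_prime_edixhoven_or_twist_or_twistAtTwo_gamma0
    (hM : mazur_not_dvd_maninConstant_of_odd)
    (hAU : abbesUllmo_not_dvd_maninConstant_of_not_dvd_level)
    (hC : cesnavicius_not_two_dvd_maninConstant_of_two_dvd_level)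
    (hEA : edixhoven_not_dvd_maninConstant_of_not_potentiallyGoodOrdinary)
    (hEB : edixhoven_not_dvd_maninConstant_of_kodairaSymbol_ne)
    (hnf : exists_isNewformOf) {W : WeierstrassCurve ℚ}
    (hcov : ∀ (W' : WeierstrassCurve ℚ) [W'.IsElliptic] [W'.IsGloballyMinimal], IsIsogenous W W' →
      ∀ (p : ℕ) (hp : p.Prime), p ^ 2 ∣ W'.conductorNorm ℤ →
        (7 < p ∧ EdixhovenNonexceptionalAt W' p hp) ∨ @TwistSemistableWitnessAt W' p ⟨hp⟩ ∨
          (p = 2 ∧ ∃ (d : ℤ) (V : WeierstrassCurve ℚ) (_ : V.IsElliptic) (_ : V.IsGloballyMinimal),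
            (d = -1 ∨ d = 2 ∨ d = -2) ∧ IsIsogenous W' (V.quadraticTwist (d : ℚ)) ∧
            V.conductorNorm ℤ ∣ W'.conductorNorm ℤ ∧ (4 * d.natAbs) ^ 2 ∣ W'.conductorNorm ℤ ∧
            ¬ 2 ^ 2 ∣ V.conductorNorm ℤ ∧ (d = -1 ∨ 2 ∣ V.conductorNorm ℤ ∨ Odd (V.LFunction 2)) ∧
            (¬ W'.HasGoodReductionAtPrime 2 ∧ ¬ W'.HasMultiplicativeReductionAtPrime 2)))
    (W' : WeierstrassCurve ℚ) [W'.IsElliptic] [W'.IsGloballyMinimal] {N' : ℕ} [NeZero N']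
    (D' : ModularParametrizationData W' N') (hiso : IsIsogenous W W')
    (hopt : ∀ z ∈ D'.L.lattice, ∃ w ∈ periodLattice D'.f, z = D'.c * w)
    (p : ℕ) (hp : p.Prime) : ¬ (p : ℤ) ∣ D'.maninConstant :=
  (classAbsManinConstantEqOne_of_forall_sq_prime_edixhoven_or_twist_or_twistAtTwo_gamma0 hM hAU hC
    hEA hEB hnf W hcov).not_dvd_maninConstant D' hiso hopt hp

end ClassCertificate

end Literature.NumberTheory.EllipticCurves.ModularForms

end
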